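import Summits.Parity.GeneralizedHardyLittlewood.Theorems.BeyondDiagonalBeatsQuarter.OffDiagHeartCore
import Summits.Parity.GeneralizedHardyLittlewood.Theorems.BeyondDiagonalBeatsQuarter.OffDiagBlockSwitch
import Summits.Parity.GeneralizedHardyLittlewood.Theorems.BeyondDiagonalBeatsQuarter.OffDiagCoreKernels
import Summits.Parity.GeneralizedHardyLittlewood.Theorems.BeyondDiagonalBeatsQuarter.OffDiagHeartHead
import HarnessLib

/-!
# Route `PrimeLevelFamEdge`, crux K_B (stmt-Parity-20343), line `diagonal_kernel_split` rev 4, plan Ω —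
# lead key `OffDiagCoreSplit` (16:35:30Z): **the a8 SPLIT OF THE FINITE DUAL CORE over a block of levels,
# `Σ_{q∈G} offDiagCore Hf Δ′ q = coreP + coreS R + coreL R + coreX`, as named objects**

After Ω-h v4 (`offDiagCore`, `OffDiagHeartCore`) the heart is a block bound for `Σ_{q ∈ goodPrimes} offDiagCore Hf Δ′ q`.
This file fixes the four pieces of GATE G2 §(a) a8 (= a8P + a8S + a8R, plus the un-switched stratum) as kernel objects
and proves the exact identity, level by level:

* for each cell `(r, l, m, d₁, d₂, i)` with `(l/d₁, r+1) = 1` (so that `a = l/d₁` is a unit mod `q(r+1)` at every prime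
  level `q > a`) the truncated dual series of `offDiagCore` is switched to `(h₁, s)`-form
  (S3 `OffDiagBlockSwitch.tsum_trunc_dual_eq_sum_switch_fourier2`); for a unit dual modulus `h₁` and a shift `s` the
  divisor condition `h₁ ∣ ab + q(r+1)s` is the class condition `q ≡ switchClass (mod switchMod)` on the reduced modulus
  `switchMod = |h₁|/g`, `g = gcd((r+1)s, h₁)`, when `g ∣ ab`, and unsolvable otherwise
  (Strata `dvd_add_mul_iff_of_gcd`, `dvd_iff_natCast_level_eq`); and the class indicator of ONE level is the sum of
  its principal, small-conductor and large-conductor KERNELS `levelPrincipal {q} 1`, `levelSmallPart R {q} 1`,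
  `levelLargePart R {q} 1` (part 1 `OffDiagCoreKernels.ite_dvd_eq_kernels`);
* `coreWith K G Hf Δ′` (definition): the switched cells of the block core with the level kernel `K`; the three pieces
  **`coreP`**, **`coreS R`**, **`coreL R`** are `coreWith` of the three kernels, **`coreX`** (definition) is the
  un-switched stratum `(l/d₁, r+1) > 1` of the core, verbatim;
* **`sum_offDiagCore_eq_coreP_add_coreS_add_coreL_add_coreX`** — for `G` a finite set of primes `≥ 40`, `0 < Δ′ ≤ 2`,
  `R ≥ 1`, any height function `Hf`, under the displayed summability of the box transforms along shifted lattices in the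
  second variable (hypothesis `hsum`, the same as in `OffDiagPrincipalBlock.tsum_levelPrincipal_eq_zero_of_height_le`):
  `Σ_{q∈G} offDiagCore Hf Δ′ q = coreP G Hf Δ′ + coreS R G Hf Δ′ + coreL R G Hf Δ′ + coreX G Hf Δ′`;
* (the stratum data `switchGcd/switchMod/switchClass`, `ite_dvd_eq_kernels` and the kernel ↔ `levelPrincipal/levelSmallPart/
  levelLargePart` bridges live in part 1 `OffDiagCoreKernels`;)
* `levelBody`, `switchedCell K`, `unswitchedCell` (definitions) — the common outer shell `−re(2q̂(2π/q)·Σ_{r,l,m} c_l c_m Σ_{d,i} ·)`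
  and the two kinds of cells; `offDiagCore_eq_levelBody`, `truncDual_eq_cells`, `offDiagCore_eq_pieces` (one level);

The level sum `Σ_{q∈G}` is kept OUTERMOST in every piece (no `q`-free enlargement of the index ranges here: that exchange,
cell type by cell type, is the consumer's — L7d for `coreL`, A8P/E14 for `coreP`). Definitions + finite algebra over landed
identities; standard axioms. Helper toward `stub_offDiagBelowSlack_io`; closes nothing.
«The programme SEARCHES and TYPES; no claim about Landau–Siegel zeros, Theorems 1–2 of arXiv:2211.02515 or
a repaired Margin232 until a kernel theorem says so.»
-/

noncomputable section

open Finset Polynomial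
open scoped Real FourierTransform

namespace Summit.Parity.GeneralizedHardyLittlewood.Theorems.BeyondDiagonalBeatsQuarter.OffDiag

open Literature.NumberTheory.LFunctions Literature.NumberTheory.LFunctions.KMV2000
open Literature.NumberTheory.Sieve.FriedlanderIwaniecPrimes (fourier2)
open PeterssonSplit (nearBoxes)

/-! ### §2. The pieces of the block core -/

/-- **The level body**: `−re(2q̂(2π/q)·Σ_{r<q⁷}Σ_{l,m≤q̂^{Δ′}} c_l c_m·Σ_{d₁∣l}Σ_{d₂∣m}Σ_{i∈nearBoxes} T(r,l,m,d₁,d₂,i))` for a cell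
function `T` — the common outer shell of `offDiagNearHead`, `offDiagCore` and all pieces below.
[cite: KowalskiMichelVanderKam2000, §6 p. 19, (21)–(23) p. 12 — derivation] -/
def levelBody (q : ℕ) [NeZero q] (Δ' : ℝ) (T : ℕ → ℕ → ℕ → ℕ → ℕ → ℕ × ℕ → ℂ) : ℝ :=
  -(2 * (qhat q : ℂ) * (2 * π / q) *
      ∑ r ∈ Finset.range (q ^ 7), ∑ l ∈ Icc 1 ⌊qhat q ^ Δ'⌋₊, ∑ m ∈ Icc 1 ⌊qhat q ^ Δ'⌋₊,
        ((mollifierCoeff (X ^ 2) (qhat q ^ Δ') l * mollifierCoeff (X ^ 2) (qhat q ^ Δ') m : ℝ) : ℂ) *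
          ∑ d₁ ∈ l.divisors, ∑ d₂ ∈ m.divisors, ∑ i ∈ nearBoxes q d₁ d₂ (Real.log q ^ 4), T r l m d₁ d₂ i).re

/-- The level body is additive in the cell function. [folklore] -/
theorem levelBody_add (q : ℕ) [NeZero q] (Δ' : ℝ) (T₁ T₂ : ℕ → ℕ → ℕ → ℕ → ℕ → ℕ × ℕ → ℂ) :
    levelBody q Δ' (fun r l m d₁ d₂ i ↦ T₁ r l m d₁ d₂ i + T₂ r l m d₁ d₂ i) =
      levelBody q Δ' T₁ + levelBody q Δ' T₂ := by
  simp only [levelBody, Finset.sum_add_distrib, mul_add, Complex.add_re, neg_add]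

/-- The level body only sees the cells of the range. [folklore] -/
theorem levelBody_congr (q : ℕ) [NeZero q] (Δ' : ℝ) {T₁ T₂ : ℕ → ℕ → ℕ → ℕ → ℕ → ℕ × ℕ → ℂ}
    (h : ∀ r ∈ Finset.range (q ^ 7), ∀ l ∈ Icc 1 ⌊qhat q ^ Δ'⌋₊, ∀ m ∈ Icc 1 ⌊qhat q ^ Δ'⌋₊,
      ∀ d₁ ∈ l.divisors, ∀ d₂ ∈ m.divisors, ∀ i ∈ nearBoxes q d₁ d₂ (Real.log q ^ 4),
        T₁ r l m d₁ d₂ i = T₂ r l m d₁ d₂ i) :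
    levelBody q Δ' T₁ = levelBody q Δ' T₂ := by
  unfold levelBody
  refine neg_re_mul_congr (Finset.sum_congr rfl fun r hr ↦ Finset.sum_congr rfl fun l hl ↦
    Finset.sum_congr rfl fun m hm ↦ congrArg _ ?_)
  exact Finset.sum_congr rfl fun d₁ hd₁ ↦ Finset.sum_congr rfl fun d₂ hd₂ ↦ Finset.sum_congr rfl fun i hi ↦
    h r hr l hl m hm d₁ hd₁ d₂ hd₂ i hi

/-- `offDiagCore` is the level body of its truncated dual cells. [folklore] -/
theorem offDiagCore_eq_levelBody (Hf : ℕ → ℕ → ℕ → ℕ → ℕ → ℕ → ℕ × ℕ → ℕ) (Δ' : ℝ) (q : ℕ) [NeZero q] :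
    offDiagCore Hf Δ' q = levelBody q Δ' (fun r l m d₁ d₂ i ↦
      ∑' h : ℤ × ℤ,
        (if |h.1| ≤ (Hf q d₁ d₂ (l / d₁) (m / d₂) (r + 1) i : ℤ) then
          fourier2 (boxWeight q d₁ d₂ (l / d₁) (m / d₂) (r + 1) i) (h.1 / (q * (r + 1) : ℕ)) (h.2 / (q * (r + 1) : ℕ)) *
            (dualCount (q * (r + 1)) ((l / d₁ : ℕ) : ZMod (q * (r + 1))) ((m / d₂ : ℕ) : ZMod (q * (r + 1)))
              (h.1 : ZMod (q * (r + 1))) (h.2 : ZMod (q * (r + 1))) : ℂ)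
        else 0)) := by
  unfold offDiagCore levelBody
  rw [dif_neg (NeZero.ne q)]

open Classical in
/-- **The switched cell with a level kernel `K`** (`K c A s h₁ q`: Petersson index, `A = ab`, switched pair, level), at
level `q`: `𝟙[(l/d₁, r+1)=1]·Σ_{|h₁|≤Hf} 𝟙[h₁ unit mod q(r+1)]·Σ'_{s} 𝟙[g ∣ ab ∧ class unit]·K·Φ̂_i(h₁/(q(r+1)), s/h₁ + ab/(h₁q(r+1)))`.
[cite: KowalskiMichelVanderKam2000, §6 p. 19, (21)–(23) p. 12 — derivation] -/
def switchedCell (K : ℕ → ℤ → ℤ → ℤ → ℕ → ℂ) (Hf : ℕ → ℕ → ℕ → ℕ → ℕ → ℕ → ℕ × ℕ → ℕ) (q : ℕ)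
    (r l m d₁ d₂ : ℕ) (i : ℕ × ℕ) : ℂ :=
  if Nat.Coprime (l / d₁) (r + 1) then
    ∑ h₁ ∈ Icc (-(Hf q d₁ d₂ (l / d₁) (m / d₂) (r + 1) i : ℤ)) (Hf q d₁ d₂ (l / d₁) (m / d₂) (r + 1) i),
      if IsUnit ((h₁ : ℤ) : ZMod (q * (r + 1))) then
        ∑' s : ℤ,
          if ((switchGcd (r + 1) s h₁ : ℤ) ∣ ((l / d₁ : ℕ) : ℤ) * (m / d₂ : ℕ) ∧
              IsUnit (switchClass (r + 1) (((l / d₁ : ℕ) : ℤ) * (m / d₂ : ℕ)) s h₁)) then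
            K (r + 1) (((l / d₁ : ℕ) : ℤ) * (m / d₂ : ℕ)) s h₁ q *
              fourier2 (boxWeight q d₁ d₂ (l / d₁) (m / d₂) (r + 1) i) (h₁ / (q * (r + 1) : ℕ))
                ((s : ℝ) / h₁ + (((l / d₁ : ℕ) : ℤ) * (m / d₂ : ℕ) : ℝ) / ((h₁ : ℝ) * (q * (r + 1) : ℕ)))
          else 0
      else 0
  else 0

open Classical in
/-- **The un-switched cell**: the truncated dual series of `offDiagCore` on the cells with `(l/d₁, r+1) > 1`, else `0`.
[cite: KowalskiMichelVanderKam2000, §6 p. 19 — derivation] -/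
def unswitchedCell (Hf : ℕ → ℕ → ℕ → ℕ → ℕ → ℕ → ℕ × ℕ → ℕ) (q : ℕ) [NeZero q]
    (r l m d₁ d₂ : ℕ) (i : ℕ × ℕ) : ℂ :=
  if Nat.Coprime (l / d₁) (r + 1) then 0 else
    ∑' h : ℤ × ℤ,
      (if |h.1| ≤ (Hf q d₁ d₂ (l / d₁) (m / d₂) (r + 1) i : ℤ) then
        fourier2 (boxWeight q d₁ d₂ (l / d₁) (m / d₂) (r + 1) i) (h.1 / (q * (r + 1) : ℕ)) (h.2 / (q * (r + 1) : ℕ)) *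
          (dualCount (q * (r + 1)) ((l / d₁ : ℕ) : ZMod (q * (r + 1))) ((m / d₂ : ℕ) : ZMod (q * (r + 1)))
            (h.1 : ZMod (q * (r + 1))) (h.2 : ZMod (q * (r + 1))) : ℂ)
      else 0)

/-- **The switched part of the block core with level kernel `K`**: `Σ_{q∈G}` of the level bodies of the switched cells
(`0` at `q = 0`). [cite: KowalskiMichelVanderKam2000, §6 p. 19 — derivation] -/
def coreWith (K : ℕ → ℤ → ℤ → ℤ → ℕ → ℂ) (G : Finset ℕ) (Hf : ℕ → ℕ → ℕ → ℕ → ℕ → ℕ → ℕ × ℕ → ℕ)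
    (Δ' : ℝ) : ℝ :=
  ∑ q ∈ G, if hq : q = 0 then 0 else
    (haveI : NeZero q := ⟨hq⟩; levelBody q Δ' (switchedCell K Hf q))

/-- **a8P — the principal piece of the block core** (kernel `levelPrincipal {q} 1 n = φ(n)⁻¹·𝟙[q unit mod n]` on the
reduced modulus `n = switchMod`). [cite: KowalskiMichelVanderKam2000, §6 p. 19 — derivation] -/
def coreP (G : Finset ℕ) (Hf : ℕ → ℕ → ℕ → ℕ → ℕ → ℕ → ℕ × ℕ → ℕ) (Δ' : ℝ) : ℝ :=
  coreWith (fun c _ s h₁ q ↦ levelPrincipal {q} (fun _ ↦ (1 : ℂ)) (switchMod c s h₁)) G Hf Δ'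

/-- **a8S — the small-conductor piece** (kernel `levelSmallPart R {q} 1 n a = φ(n)⁻¹Σ_{1<cond χ≤R} χ(a⁻¹)χ(q)` on the reduced
modulus and class). [cite: KowalskiMichelVanderKam2000, §6 p. 19 — derivation; Davenport1980, ch. 29 — derivation] -/
def coreS (R : ℕ) (G : Finset ℕ) (Hf : ℕ → ℕ → ℕ → ℕ → ℕ → ℕ → ℕ × ℕ → ℕ) (Δ' : ℝ) : ℝ :=
  coreWith (fun c A s h₁ q ↦ levelSmallPart R {q} (fun _ ↦ (1 : ℂ)) (switchMod c s h₁) (switchClass c A s h₁)) G Hf Δ'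

/-- **a8R — the large-conductor piece** (kernel `levelLargePart R {q} 1 n a = φ(n)⁻¹Σ_{cond χ>R} χ(a⁻¹)χ(q)` on the reduced
modulus and class). [cite: KowalskiMichelVanderKam2000, §6 p. 19 — derivation; Davenport1980, ch. 29 — derivation] -/
def coreL (R : ℕ) (G : Finset ℕ) (Hf : ℕ → ℕ → ℕ → ℕ → ℕ → ℕ → ℕ × ℕ → ℕ) (Δ' : ℝ) : ℝ :=
  coreWith (fun c A s h₁ q ↦ levelLargePart R {q} (fun _ ↦ (1 : ℂ)) (switchMod c s h₁) (switchClass c A s h₁)) G Hf Δ'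

/-- **The un-switched stratum of the block core** (cells `(l/d₁, r+1) > 1`, truncated dual series verbatim).
[cite: KowalskiMichelVanderKam2000, §6 p. 19 — derivation] -/
def coreX (G : Finset ℕ) (Hf : ℕ → ℕ → ℕ → ℕ → ℕ → ℕ → ℕ × ℕ → ℕ) (Δ' : ℝ) : ℝ :=
  ∑ q ∈ G, if hq : q = 0 then 0 else
    (haveI : NeZero q := ⟨hq⟩; levelBody q Δ' (unswitchedCell Hf q))

/-! ### §3. The identity, cell by cell and level by level -/

section Cell

variable {q : ℕ} [NeZero q]

omit [NeZero q] in
/-- The first Kloosterman frequency `a = l/d₁` (`1 ≤ a ≤ ⌊q̂^{Δ′}⌋ < q`) is a unit modulo `q(r+1)` when `(a, r+1) = 1`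
(`q` prime `≥ 40`, `Δ′ ≤ 2`). [folklore] -/
theorem isUnit_firstFreq (hq : 40 ≤ q) (hp : q.Prime) {Δ' : ℝ} (h0 : 0 < Δ') (h2 : Δ' ≤ 2) {l d₁ r : ℕ}
    (hl : l ∈ Icc 1 ⌊qhat q ^ Δ'⌋₊) (hd₁ : d₁ ∈ l.divisors) (hcop : Nat.Coprime (l / d₁) (r + 1)) :
    IsUnit (((l / d₁ : ℕ) : ℕ) : ZMod (q * (r + 1))) := by
  rw [ZMod.isUnit_iff_coprime]
  have hl1 : 1 ≤ l := (Finset.mem_Icc.mp hl).1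
  have ha1 : 1 ≤ l / d₁ := OffDiagDual.one_le_div_of_dvd (Nat.dvd_of_mem_divisors hd₁) hl1
  have halt : l / d₁ < q :=
    lt_of_le_of_lt ((Nat.div_le_self l d₁).trans (Finset.mem_Icc.mp hl).2) (floor_qhat_rpow_lt (by omega) h0 h2)
  exact Nat.Coprime.mul_right (Nat.coprime_of_lt_prime (by omega) halt hp).symm hcop

/-- **One cell of the core is the sum of its four pieces.** For `q` prime `≥ 40`, `Δ′ ≤ 2`, `R ≥ 1`, a cell
`(r, l, m, d₁, d₂, i)` of the range, and the shifted-lattice summability of the box transforms: the truncated dual series of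
`offDiagCore` equals `switchedCell K_P + switchedCell K_S + switchedCell K_L + unswitchedCell`.
[cite: KowalskiMichelVanderKam2000, Lemma 3.3 p. 9, §6 p. 19 — derivation] -/
theorem truncDual_eq_cells (hq : 40 ≤ q) (hp : q.Prime) {Δ' : ℝ} (h0 : 0 < Δ') (h2 : Δ' ≤ 2) {R : ℕ} (hR : 1 ≤ R)
    (Hf : ℕ → ℕ → ℕ → ℕ → ℕ → ℕ → ℕ × ℕ → ℕ)
    (hsum : ∀ (d₁ d₂ α β c : ℕ) (i : ℕ × ℕ) (ξ₁ τ : ℝ) (h₁ : ℤ), h₁ ≠ 0 →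
      Summable (fun s : ℤ ↦ fourier2 (boxWeight q d₁ d₂ α β c i) ξ₁ ((s : ℝ) / h₁ + τ)))
    {r l m d₁ d₂ : ℕ} {i : ℕ × ℕ} (hl : l ∈ Icc 1 ⌊qhat q ^ Δ'⌋₊) (hm : m ∈ Icc 1 ⌊qhat q ^ Δ'⌋₊)
    (hd₁ : d₁ ∈ l.divisors) (hd₂ : d₂ ∈ m.divisors) :
    (∑' h : ℤ × ℤ,
        (if |h.1| ≤ (Hf q d₁ d₂ (l / d₁) (m / d₂) (r + 1) i : ℤ) then
          fourier2 (boxWeight q d₁ d₂ (l / d₁) (m / d₂) (r + 1) i) (h.1 / (q * (r + 1) : ℕ)) (h.2 / (q * (r + 1) : ℕ)) *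
            (dualCount (q * (r + 1)) ((l / d₁ : ℕ) : ZMod (q * (r + 1))) ((m / d₂ : ℕ) : ZMod (q * (r + 1)))
              (h.1 : ZMod (q * (r + 1))) (h.2 : ZMod (q * (r + 1))) : ℂ)
        else 0)) =
      switchedCell (fun c _ s h₁ q ↦ levelPrincipal {q} (fun _ ↦ (1 : ℂ)) (switchMod c s h₁)) Hf q r l m d₁ d₂ i +
        switchedCell (fun c A s h₁ q ↦ levelSmallPart R {q} (fun _ ↦ (1 : ℂ)) (switchMod c s h₁) (switchClass c A s h₁))
          Hf q r l m d₁ d₂ i +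
        switchedCell (fun c A s h₁ q ↦ levelLargePart R {q} (fun _ ↦ (1 : ℂ)) (switchMod c s h₁) (switchClass c A s h₁))
          Hf q r l m d₁ d₂ i +
        unswitchedCell Hf q r l m d₁ d₂ i := by
  classical
  by_cases hcop : Nat.Coprime (l / d₁) (r + 1)
  swap
  · simp only [switchedCell, unswitchedCell, if_neg hcop, zero_add]
  simp only [switchedCell, unswitchedCell, if_pos hcop, add_zero]
  -- the ranges
  have hl1 : 1 ≤ l := (Finset.mem_Icc.mp hl).1
  have hm1 : 1 ≤ m := (Finset.mem_Icc.mp hm).1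
  have hd₁1 : 1 ≤ d₁ := Nat.pos_of_mem_divisors hd₁
  have hd₂1 : 1 ≤ d₂ := Nat.pos_of_mem_divisors hd₂
  have ha1 : 1 ≤ l / d₁ := OffDiagDual.one_le_div_of_dvd (Nat.dvd_of_mem_divisors hd₁) hl1
  have hb1 : 1 ≤ m / d₂ := OffDiagDual.one_le_div_of_dvd (Nat.dvd_of_mem_divisors hd₂) hm1
  have hq2 : 2 ≤ q := by omega
  have hC : 2 ≤ q * (r + 1) := le_trans hq2 (Nat.le_mul_of_pos_right q (Nat.succ_pos r))
  haveI : NeZero (q * (r + 1)) := ⟨by omega⟩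
  have ha : IsUnit (((l / d₁ : ℕ) : ℕ) : ZMod (q * (r + 1))) := isUnit_firstFreq hq hp h0 h2 hl hd₁ hcop
  -- Step 1: the switch (S3)
  rw [tsum_trunc_dual_eq_sum_switch_fourier2 hC ha (m / d₂) _ _ (summable_dual hd₁1 hd₂1 ha1 hb1 i)]
  -- Step 2: per dual modulus
  rw [← Finset.sum_add_distrib, ← Finset.sum_add_distrib]
  refine Finset.sum_congr rfl fun h₁ _ ↦ ?_
  by_cases hu : IsUnit ((h₁ : ℤ) : ZMod (q * (r + 1)))
  swap
  · simp only [if_neg hu, add_zero]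
  simp only [if_pos hu]
  have hh₁ : h₁ ≠ 0 := intCast_ne_zero_of_isUnit hC hu
  -- abbreviations
  set A : ℤ := ((l / d₁ : ℕ) : ℤ) * (m / d₂ : ℕ) with hA
  set Φh : ℤ → ℂ := fun s ↦ fourier2 (boxWeight q d₁ d₂ (l / d₁) (m / d₂) (r + 1) i) (h₁ / (q * (r + 1) : ℕ))
      ((s : ℝ) / h₁ + (((l / d₁ : ℕ) : ℤ) * (m / d₂ : ℕ) : ℝ) / ((h₁ : ℝ) * (q * (r + 1) : ℕ))) with hΦh
  have hΦs : Summable Φh := by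
    have := hsum d₁ d₂ (l / d₁) (m / d₂) (r + 1) i ((h₁ : ℝ) / (q * (r + 1) : ℕ))
      ((((l / d₁ : ℕ) : ℤ) * (m / d₂ : ℕ) : ℝ) / ((h₁ : ℝ) * (q * (r + 1) : ℕ))) h₁ hh₁
    simpa only [hΦh] using this
  -- the three kernel families are summable (kernels bounded by one)
  have hKsum : ∀ (K : ℤ → ℂ), (∀ s, ‖K s‖ ≤ 1) →
      Summable (fun s : ℤ ↦ if ((switchGcd (r + 1) s h₁ : ℤ) ∣ A ∧ IsUnit (switchClass (r + 1) A s h₁)) then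
        K s * Φh s else 0) := by
    intro K hK
    refine Summable.of_norm_bounded hΦs.norm fun s ↦ ?_
    split_ifs
    · rw [norm_mul]
      calc ‖K s‖ * ‖Φh s‖ ≤ 1 * ‖Φh s‖ := mul_le_mul_of_nonneg_right (hK s) (norm_nonneg _)
        _ = ‖Φh s‖ := one_mul _
    · rw [norm_zero]; exact norm_nonneg _
  have hKP := hKsum (fun s ↦ levelPrincipal {q} (fun _ ↦ (1 : ℂ)) (switchMod (r + 1) s h₁)) fun s ↦ by
    haveI : NeZero (switchMod (r + 1) s h₁) := ⟨switchMod_ne_zero _ s hh₁⟩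
    exact (norm_kernels_le R (switchClass (r + 1) A s h₁)).1
  have hKS := hKsum (fun s ↦ levelSmallPart R {q} (fun _ ↦ (1 : ℂ)) (switchMod (r + 1) s h₁)
      (switchClass (r + 1) A s h₁)) fun s ↦ by
    haveI : NeZero (switchMod (r + 1) s h₁) := ⟨switchMod_ne_zero _ s hh₁⟩
    exact (norm_kernels_le R (switchClass (r + 1) A s h₁)).2.1
  have hKL := hKsum (fun s ↦ levelLargePart R {q} (fun _ ↦ (1 : ℂ)) (switchMod (r + 1) s h₁)
      (switchClass (r + 1) A s h₁)) fun s ↦ by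
    haveI : NeZero (switchMod (r + 1) s h₁) := ⟨switchMod_ne_zero _ s hh₁⟩
    exact (norm_kernels_le R (switchClass (r + 1) A s h₁)).2.2
  -- Step 3: pointwise in `s`, the divisor indicator is the sum of the three kernels
  have hpt : ∀ s : ℤ, (if h₁ ∣ ((l / d₁ : ℕ) : ℤ) * (m / d₂ : ℕ) + ((q * (r + 1) : ℕ) : ℤ) * s then Φh s else 0) =
      (if ((switchGcd (r + 1) s h₁ : ℤ) ∣ A ∧ IsUnit (switchClass (r + 1) A s h₁)) then
          levelPrincipal {q} (fun _ ↦ (1 : ℂ)) (switchMod (r + 1) s h₁) * Φh s else 0) +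
      ((if ((switchGcd (r + 1) s h₁ : ℤ) ∣ A ∧ IsUnit (switchClass (r + 1) A s h₁)) then
          levelSmallPart R {q} (fun _ ↦ (1 : ℂ)) (switchMod (r + 1) s h₁) (switchClass (r + 1) A s h₁) * Φh s else 0) +
      (if ((switchGcd (r + 1) s h₁ : ℤ) ∣ A ∧ IsUnit (switchClass (r + 1) A s h₁)) then
          levelLargePart R {q} (fun _ ↦ (1 : ℂ)) (switchMod (r + 1) s h₁) (switchClass (r + 1) A s h₁) * Φh s else 0)) := by
    intro s
    have hk := ite_dvd_eq_kernels hC hu A s hR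
    have e1 : (if h₁ ∣ ((l / d₁ : ℕ) : ℤ) * (m / d₂ : ℕ) + ((q * (r + 1) : ℕ) : ℤ) * s then Φh s else 0) =
        (if h₁ ∣ A + ((q * (r + 1) : ℕ) : ℤ) * s then (1 : ℂ) else 0) * Φh s := by
      rw [hA]; split_ifs <;> simp
    rw [e1, hk]
    split_ifs <;> ring
  have hpt' : ∀ s : ℤ, (if h₁ ∣ ((l / d₁ : ℕ) : ℤ) * (m / d₂ : ℕ) + ((q * (r + 1) : ℕ) : ℤ) * s then
      fourier2 (boxWeight q d₁ d₂ (l / d₁) (m / d₂) (r + 1) i) (h₁ / (q * (r + 1) : ℕ))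
        ((s : ℝ) / h₁ + (((l / d₁ : ℕ) : ℤ) * (m / d₂ : ℕ) : ℝ) / ((h₁ : ℝ) * (q * (r + 1) : ℕ))) else 0) =
      (if ((switchGcd (r + 1) s h₁ : ℤ) ∣ A ∧ IsUnit (switchClass (r + 1) A s h₁)) then
          levelPrincipal {q} (fun _ ↦ (1 : ℂ)) (switchMod (r + 1) s h₁) * Φh s else 0) +
      ((if ((switchGcd (r + 1) s h₁ : ℤ) ∣ A ∧ IsUnit (switchClass (r + 1) A s h₁)) then
          levelSmallPart R {q} (fun _ ↦ (1 : ℂ)) (switchMod (r + 1) s h₁) (switchClass (r + 1) A s h₁) * Φh s else 0) +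
      (if ((switchGcd (r + 1) s h₁ : ℤ) ∣ A ∧ IsUnit (switchClass (r + 1) A s h₁)) then
          levelLargePart R {q} (fun _ ↦ (1 : ℂ)) (switchMod (r + 1) s h₁) (switchClass (r + 1) A s h₁) * Φh s else 0)) :=
    fun s ↦ hpt s
  rw [tsum_congr hpt', (hKP).tsum_add (hKS.add hKL), hKS.tsum_add hKL]
  simp only [hΦh, hA]
  ring

end Cell

/-! ### §4. The level identity and the block identity -/

/-- **One level: `offDiagCore = P + S + L + X`.** For `q` prime `≥ 40`, `Δ′ ≤ 2`, `R ≥ 1`, any `Hf`, under the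
shifted-lattice summability of the box transforms at level `q`.
[cite: KowalskiMichelVanderKam2000, §6 p. 19, (21)–(23) p. 12, Lemma 3.3 p. 9 — derivation] -/
theorem offDiagCore_eq_pieces {q : ℕ} [NeZero q] (hq : 40 ≤ q) (hp : q.Prime) {Δ' : ℝ} (h0 : 0 < Δ') (h2 : Δ' ≤ 2) {R : ℕ}
    (hR : 1 ≤ R) (Hf : ℕ → ℕ → ℕ → ℕ → ℕ → ℕ → ℕ × ℕ → ℕ)
    (hsum : ∀ (d₁ d₂ α β c : ℕ) (i : ℕ × ℕ) (ξ₁ τ : ℝ) (h₁ : ℤ), h₁ ≠ 0 →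
      Summable (fun s : ℤ ↦ fourier2 (boxWeight q d₁ d₂ α β c i) ξ₁ ((s : ℝ) / h₁ + τ))) :
    offDiagCore Hf Δ' q =
      levelBody q Δ' (switchedCell (fun c _ s h₁ q ↦ levelPrincipal {q} (fun _ ↦ (1 : ℂ)) (switchMod c s h₁)) Hf q) +
        levelBody q Δ' (switchedCell
          (fun c A s h₁ q ↦ levelSmallPart R {q} (fun _ ↦ (1 : ℂ)) (switchMod c s h₁) (switchClass c A s h₁)) Hf q) +
        levelBody q Δ' (switchedCell
          (fun c A s h₁ q ↦ levelLargePart R {q} (fun _ ↦ (1 : ℂ)) (switchMod c s h₁) (switchClass c A s h₁)) Hf q) +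
        levelBody q Δ' (unswitchedCell Hf q) := by
  rw [offDiagCore_eq_levelBody, ← levelBody_add, ← levelBody_add, ← levelBody_add]
  exact levelBody_congr q Δ' fun r _ l hl m hm d₁ hd₁ d₂ hd₂ i _ ↦
    truncDual_eq_cells hq hp h0 h2 hR Hf hsum hl hm hd₁ hd₂

/-- **The a8 split of the finite dual core over a block** (lead key `OffDiagCoreSplit`): for a finite set `G` of prime levels
`≥ 40`, `0 < Δ′ ≤ 2`, `R ≥ 1`, any height function `Hf`, and the shifted-lattice summability of the box transforms at the levels
of `G`: `Σ_{q∈G} offDiagCore Hf Δ′ q = coreP G Hf Δ′ + coreS R G Hf Δ′ + coreL R G Hf Δ′ + coreX G Hf Δ′`.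
[cite: KowalskiMichelVanderKam2000, §6 p. 19, (21)–(23) p. 12, Lemma 3.3 p. 9 — derivation; Davenport1980, ch. 29 — derivation] -/
theorem sum_offDiagCore_eq_coreP_add_coreS_add_coreL_add_coreX (G : Finset ℕ) (hG : ∀ q ∈ G, q.Prime ∧ 40 ≤ q)
    {Δ' : ℝ} (h0 : 0 < Δ') (h2 : Δ' ≤ 2) {R : ℕ} (hR : 1 ≤ R) (Hf : ℕ → ℕ → ℕ → ℕ → ℕ → ℕ → ℕ × ℕ → ℕ)
    (hsum : ∀ q ∈ G, ∀ (d₁ d₂ α β c : ℕ) (i : ℕ × ℕ) (ξ₁ τ : ℝ) (h₁ : ℤ), h₁ ≠ 0 →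
      Summable (fun s : ℤ ↦ fourier2 (boxWeight q d₁ d₂ α β c i) ξ₁ ((s : ℝ) / h₁ + τ))) :
    ∑ q ∈ G, offDiagCore Hf Δ' q = coreP G Hf Δ' + coreS R G Hf Δ' + coreL R G Hf Δ' + coreX G Hf Δ' := by
  unfold coreP coreS coreL coreX coreWith
  rw [← Finset.sum_add_distrib, ← Finset.sum_add_distrib, ← Finset.sum_add_distrib]
  refine Finset.sum_congr rfl fun q hqG ↦ ?_
  obtain ⟨hp, hq⟩ := hG q hqG
  have hq0 : q ≠ 0 := hp.ne_zero
  haveI : NeZero q := ⟨hq0⟩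
  simp only [dif_neg hq0]
  exact offDiagCore_eq_pieces hq hp h0 h2 hR Hf (hsum q hqG)

end Summit.Parity.GeneralizedHardyLittlewood.Theorems.BeyondDiagonalBeatsQuarter.OffDiag
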